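/-
Copyright: statement-level skeleton of a published paper (lit-balaban cell, Phase-2 proof seat p25, gen 17). No proof
claims beyond what the kernel checks below.
-/
import Literature.MathematicalPhysics.QuantumFieldTheory.BalabanImbrieJaffe1984to88.BIJ88LabelledRun311

/-!
# `BalabanImbrieJaffe1984to88.BIJ88ComponentCubes311` — T. Bałaban, J. Imbrie, A. Jaffe, *Effective action and cluster
properties of the abelian Higgs model*, Commun. Math. Phys. **114** (1988) 257–315 [BalabanImbrieJaffe1988], §5.14
p. 311 [PDF 55]: *"For each term, let X be the union of the cubes covering the X_{σ_i} and the regions from the random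
walk expansion. … We break up the observable according to the connected components of X."* — **THE CUBES OF A
COMPONENT.**  In the labelled expansion of p25 gen 16 (`BIJ88LabelledRun311`) a component records its pending legs and
the observables it contains; given a LOCATION `loc w` of every leg `w` in a (pseudo)metric space of cubes, print's set
`X` of a component becomes `cubes loc obs X` = the locations of its pending legs and of all legs of its observables.
This file is the bookkeeping of how `X` grows under the six integration-by-parts events of `run` (triangle inequality
`diam(X ∪ Y) ≤ diam X + dist(x, y) + diam Y` at the contraction `x — y`), used by the sibling `BIJ88LabelledDiamDecay312`
to prove that weights decay in `diam X`.

statement-level skeleton of published theorems with citation tags; proofs where landed; nothing here is a claim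
about the Yang–Mills mass gap

PDF held: `paper:balaban1988-cmp114-bij-abelian-higgs-effective-action` (journal page = PDF page + 256); p. 311 = PDF 55
(`p0055.txt` L28–35 re-read this session; the quoted sentences are verbatim there up to the OCR of sub/superscripts).

CITATION HEADER (lean-in-tree rule).  lit-balaban cell (HOME `run/shared/lean/pub/lit-balaban/`), Phase 2, seat p25
gen 17; row **C2.Claim@312** of `HOME/lit-balaban-r16/ROWS-C2-part2.md` (owner r16, referee ref-5; head
`BIJ88Sect5StatementsPart4.Ineq312` NOT touched — a MEMBER; first item of honest-scope (ii) GEOMETRY of the gen-16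
HANDOFF).  USED BY NAME, nothing restated: `BIJ88LabelledRun311` (`LGrp`, `pristine`, `LGrp.absorb`), Mathlib's
`Metric.diam` (`Metric.diam_union`, `Metric.diam_mono`, `Metric.diam_le_of_forall_dist_le`).

## What is proved (0 `sorry`, standard axioms, no `Prop` facts; one definition with body: `cubes`)

* `cubes` (print's `X` of a component in the labelled model); `cubes_finite`, `loc_mem_cubes_of_pend/_of_lab`,
  `cubes_subset`, `diam_le_of_subset_union`, `diam_le_of_subset`, `diam_image_le`, `diam_cubes_pristine` (a pristine
  observable's cubes have diameter `≤ r₀`), and the four event inequalities **`diam_cubes_pair_le`** (contraction inside /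
  to the source / to `χ′`: no growth), **`diam_cubes_pristine_le`** (`+ dist + r₀`), **`diam_cubes_absorb_le`**
  (`+ dist + diam(absorbed)`), **`diam_cubes_vertex_le`** (`+ dist + r₀`).
HONEST SCOPE: bookkeeping only; `loc`, `r₀` free; components are the contraction-graph components of the siblings (no
connectedness of `X` is claimed — with one covariance of unrestricted range it does not hold).  NOT summit progress; NOT
continuum; NOT Clay.  Imports `BIJ88LabelledRun311` only; modifies nothing.
-/

noncomputable section

namespace Literature.MathematicalPhysics.QuantumFieldTheory.BalabanImbrieJaffe1984to88.BIJ88ComponentCubes311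

open Classical Finset
open BIJ88LabelledRun311

variable {S : Type} [Fintype S] [DecidableEq S] {ι : Type} [Fintype ι] {κ : Type}
variable {β : Type} [PseudoMetricSpace β]

/-! ## §1  The cubes of a component and the growth of their diameter under the six events -/

section Cubes

variable (loc : (S → ℝ) → β) (obs : κ → List (S → ℝ))

/-- **The cubes of a component** (p. 311 *"let X be the union of the cubes covering the X_{σ_i} and the regions from
the random walk expansion"*, in the labelled model): the locations of its pending legs and of all legs of the
observables it contains. [cite: BalabanImbrieJaffe1988, §5.14 p.311] -/
def cubes (g : LGrp S κ) : Set β := loc '' {w | w ∈ g.pend ∨ ∃ j ∈ g.lab, w ∈ obs j}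

omit [Fintype S] [DecidableEq S] [PseudoMetricSpace β] in
/-- The cubes of a component are finitely many. [cite: BalabanImbrieJaffe1988, §5.14 p.311] -/
theorem cubes_finite (g : LGrp S κ) : (cubes loc obs g).Finite := by
  refine Set.Finite.image _ (Set.Finite.subset ((g.pend.finite_toSet).union
    (Set.Finite.biUnion (Finset.finite_toSet g.lab) fun j _ => (obs j).finite_toSet)) ?_)
  intro w hw
  rcases hw with hw | ⟨j, hj, hw⟩
  · exact Or.inl hw
  · exact Or.inr (Set.mem_biUnion (Finset.mem_coe.2 hj) hw)

omit [Fintype S] [DecidableEq S] [PseudoMetricSpace β] in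
/-- A pending leg sits in the cubes. [cite: BalabanImbrieJaffe1988, §5.14 p.311] -/
theorem loc_mem_cubes_of_pend {g : LGrp S κ} {w : S → ℝ} (hw : w ∈ g.pend) : loc w ∈ cubes loc obs g :=
  ⟨w, Or.inl hw, rfl⟩

omit [Fintype S] [DecidableEq S] [PseudoMetricSpace β] in
/-- A leg of a contained observable sits in the cubes. [cite: BalabanImbrieJaffe1988, §5.14 p.311] -/
theorem loc_mem_cubes_of_lab {g : LGrp S κ} {j : κ} (hj : j ∈ g.lab) {w : S → ℝ} (hw : w ∈ obs j) :
    loc w ∈ cubes loc obs g :=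
  ⟨w, Or.inr ⟨j, hj, hw⟩, rfl⟩

omit [Fintype S] [DecidableEq S] [PseudoMetricSpace β] in
/-- How the cubes of a new component sit inside the old ones plus an extra set (bookkeeping for the six events).
[cite: BalabanImbrieJaffe1988, §5.14 p.311] -/
theorem cubes_subset {g g' : LGrp S κ} {E : Set β} (hp : ∀ w ∈ g'.pend, loc w ∈ cubes loc obs g ∪ E)
    (hl : ∀ j ∈ g'.lab, j ∈ g.lab ∨ ∀ w ∈ obs j, loc w ∈ E) : cubes loc obs g' ⊆ cubes loc obs g ∪ E := by
  rintro _ ⟨w, hw, rfl⟩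
  rcases hw with hw | ⟨j, hj, hw⟩
  · exact hp w hw
  · rcases hl j hj with hj' | hE
    · exact Or.inl (loc_mem_cubes_of_lab loc obs hj' hw)
    · exact Or.inr (hE w hw)

omit [Fintype S] [DecidableEq S] in
/-- Diameter under inclusion into old cubes plus an extra finite set met at a contraction `x — y`
(`diam(X ∪ E) ≤ diam X + dist(x,y) + diam E`). [cite: BalabanImbrieJaffe1988, §5.14 p.311] -/
theorem diam_le_of_subset_union {g g' : LGrp S κ} {E : Set β} (hE : E.Finite)
    (hsub : cubes loc obs g' ⊆ cubes loc obs g ∪ E) {x y : β} (hx : x ∈ cubes loc obs g) (hy : y ∈ E) :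
    Metric.diam (cubes loc obs g') ≤ Metric.diam (cubes loc obs g) + dist x y + Metric.diam E :=
  (Metric.diam_mono hsub ((cubes_finite loc obs g).union hE).isBounded).trans (Metric.diam_union hx hy)

omit [Fintype S] [DecidableEq S] in
/-- Diameter under inclusion. [cite: BalabanImbrieJaffe1988, §5.14 p.311] -/
theorem diam_le_of_subset {g g' : LGrp S κ} (hsub : cubes loc obs g' ⊆ cubes loc obs g) :
    Metric.diam (cubes loc obs g') ≤ Metric.diam (cubes loc obs g) :=
  Metric.diam_mono hsub (cubes_finite loc obs g).isBounded

omit [Fintype S] [DecidableEq S] in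
/-- A local family of legs has small diameter. [folklore] [cite: BalabanImbrieJaffe1988, §5.14 p.311] -/
theorem diam_image_le {L : List (S → ℝ)} {r₀ : ℝ} (hr : 0 ≤ r₀)
    (hL : ∀ w ∈ L, ∀ w' ∈ L, dist (loc w) (loc w') ≤ r₀) : Metric.diam (loc '' {w | w ∈ L}) ≤ r₀ :=
  Metric.diam_le_of_forall_dist_le hr (by
    rintro _ ⟨w, hw, rfl⟩ _ ⟨w', hw', rfl⟩
    exact hL w hw w' hw')

omit [Fintype S] [DecidableEq S] in
/-- **The cubes of a pristine observable have diameter at most `r₀`** (local observables).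
[cite: BalabanImbrieJaffe1988, §5.14 p.311] -/
theorem diam_cubes_pristine {r₀ : ℝ} (hr : 0 ≤ r₀) (hro : ∀ j, ∀ w ∈ obs j, ∀ w' ∈ obs j, dist (loc w) (loc w') ≤ r₀)
    (j : κ) : Metric.diam (cubes loc obs (pristine obs j)) ≤ r₀ := by
  refine Metric.diam_le_of_forall_dist_le hr ?_
  rintro _ ⟨w, hw, rfl⟩ _ ⟨w', hw', rfl⟩
  have h1 : w ∈ obs j := by
    rcases hw with hw | ⟨j', hj', hw⟩
    · exact hw
    · simp only [pristine, Finset.mem_singleton] at hj'; exact hj' ▸ hw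
  have h2 : w' ∈ obs j := by
    rcases hw' with hw' | ⟨j', hj', hw'⟩
    · exact hw'
    · simp only [pristine, Finset.mem_singleton] at hj'; exact hj' ▸ hw'
  exact hro j w h1 w' h2

variable [DecidableEq κ]

omit [Fintype S] [DecidableEq S] [DecidableEq κ] in
/-- (1)/(4)/(5) **A contraction inside the component, to the source or to `χ′` does not enlarge the cubes.**
[cite: BalabanImbrieJaffe1988, §5.14 p.311] -/
theorem diam_cubes_pair_le {g : LGrp S κ} {u : S → ℝ} {L P : List (S → ℝ)} (hp : g.pend = u :: L)
    (hP : ∀ w ∈ P, w ∈ L) (nchi nv : ℕ) :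
    Metric.diam (cubes loc obs ⟨⟨P, nchi, nv⟩, g.lab⟩) ≤ Metric.diam (cubes loc obs g) := by
  refine diam_le_of_subset loc obs fun x hx => ?_
  have h := cubes_subset loc obs (g := g) (g' := ⟨⟨P, nchi, nv⟩, g.lab⟩) (E := ∅)
    (fun w hw => Or.inl (loc_mem_cubes_of_pend loc obs (by rw [hp]; exact List.mem_cons_of_mem u (hP w hw))))
    (fun j hj => Or.inl hj) hx
  simpa using h

omit [Fintype S] [DecidableEq S] in
/-- (2) **Joining a pristine observable through the contraction `u — w_i`** enlarges the diameter by at most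
`dist(loc u, loc w_i) + r₀`. [cite: BalabanImbrieJaffe1988, §5.14 p.311] -/
theorem diam_cubes_pristine_le {r₀ : ℝ} (hr : 0 ≤ r₀) (hro : ∀ j, ∀ w ∈ obs j, ∀ w' ∈ obs j, dist (loc w) (loc w') ≤ r₀)
    {g : LGrp S κ} {u : S → ℝ} {L : List (S → ℝ)} (hp : g.pend = u :: L) (j : κ) {i : ℕ} (hi : i < (obs j).length)
    (nchi nv : ℕ) :
    Metric.diam (cubes loc obs ⟨⟨L ++ (obs j).eraseIdx i, nchi, nv⟩, g.lab ∪ {j}⟩)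
      ≤ Metric.diam (cubes loc obs g) + dist (loc u) (loc ((obs j).getD i 0)) + r₀ := by
  have hsub : cubes loc obs ⟨⟨L ++ (obs j).eraseIdx i, nchi, nv⟩, g.lab ∪ {j}⟩
      ⊆ cubes loc obs g ∪ loc '' {w | w ∈ obs j} := by
    refine cubes_subset loc obs (fun w hw => ?_) (fun j' hj' => ?_)
    · rcases List.mem_append.1 hw with hw | hw
      · exact Or.inl (loc_mem_cubes_of_pend loc obs (by rw [hp]; exact List.mem_cons_of_mem u hw))
      · exact Or.inr ⟨w, List.mem_of_mem_eraseIdx hw, rfl⟩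
    · rcases Finset.mem_union.1 hj' with hj' | hj'
      · exact Or.inl hj'
      · rw [Finset.mem_singleton] at hj'
        subst hj'
        exact Or.inr fun w hw => ⟨w, hw, rfl⟩
  have hy : loc ((obs j).getD i 0) ∈ loc '' {w | w ∈ obs j} :=
    ⟨_, by rw [List.getD_eq_getElem _ _ hi]; exact List.getElem_mem hi, rfl⟩
  refine (diam_le_of_subset_union loc obs ((obs j).finite_toSet.image loc) hsub
    (loc_mem_cubes_of_pend loc obs (by rw [hp]; exact List.mem_cons_self)) hy).trans ?_
  exact add_le_add le_rfl (diam_image_le loc hr (hro j))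

omit [Fintype S] [DecidableEq S] in
/-- (3) **Absorbing a set-aside component through the contraction `u — h.pend_i`** enlarges the diameter by at most
`dist(loc u, loc h.pend_i) + diam(cubes h)`. [cite: BalabanImbrieJaffe1988, §5.14 p.311] -/
theorem diam_cubes_absorb_le {g h : LGrp S κ} {u : S → ℝ} {L : List (S → ℝ)} (hp : g.pend = u :: L) {i : ℕ}
    (hi : i < h.pend.length) :
    Metric.diam (cubes loc obs (LGrp.absorb L g h i))
      ≤ Metric.diam (cubes loc obs g) + dist (loc u) (loc (h.pend.getD i 0)) + Metric.diam (cubes loc obs h) := by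
  have hsub : cubes loc obs (LGrp.absorb L g h i) ⊆ cubes loc obs g ∪ cubes loc obs h := by
    refine cubes_subset loc obs (fun w hw => ?_) (fun j' hj' => ?_)
    · simp only [LGrp.absorb] at hw
      rcases List.mem_append.1 hw with hw | hw
      · exact Or.inl (loc_mem_cubes_of_pend loc obs (by rw [hp]; exact List.mem_cons_of_mem u hw))
      · exact Or.inr (loc_mem_cubes_of_pend loc obs (List.mem_of_mem_eraseIdx hw))
    · simp only [LGrp.absorb, Finset.mem_union] at hj'
      rcases hj' with hj' | hj'
      · exact Or.inl hj'
      · exact Or.inr fun w hw => loc_mem_cubes_of_lab loc obs hj' hw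
  have hy : loc (h.pend.getD i 0) ∈ cubes loc obs h :=
    loc_mem_cubes_of_pend loc obs (by rw [List.getD_eq_getElem _ _ hi]; exact List.getElem_mem hi)
  exact diam_le_of_subset_union loc obs (cubes_finite loc obs h) hsub
    (loc_mem_cubes_of_pend loc obs (by rw [hp]; exact List.mem_cons_self)) hy

omit [Fintype S] [DecidableEq S] [Fintype ι] [DecidableEq κ] in
/-- (6) **Differentiating down a vertex through the contraction `u — (legs m)_j`** enlarges the diameter by at most
`dist(loc u, loc (legs m)_j) + r₀` (local vertices). [cite: BalabanImbrieJaffe1988, §5.14 p.311] -/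
theorem diam_cubes_vertex_le {legs : ι → List (S → ℝ)} {r₀ : ℝ} (hr : 0 ≤ r₀)
    (hrv : ∀ m, ∀ w ∈ legs m, ∀ w' ∈ legs m, dist (loc w) (loc w') ≤ r₀)
    {g : LGrp S κ} {u : S → ℝ} {L : List (S → ℝ)} (hp : g.pend = u :: L) (m : ι) {j : ℕ} (hj : j < (legs m).length)
    (nchi nv : ℕ) :
    Metric.diam (cubes loc obs ⟨⟨L ++ (legs m).eraseIdx j, nchi, nv⟩, g.lab⟩)
      ≤ Metric.diam (cubes loc obs g) + dist (loc u) (loc ((legs m).getD j 0)) + r₀ := by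
  have hsub : cubes loc obs ⟨⟨L ++ (legs m).eraseIdx j, nchi, nv⟩, g.lab⟩ ⊆ cubes loc obs g ∪ loc '' {w | w ∈ legs m} := by
    refine cubes_subset loc obs (fun w hw => ?_) (fun j' hj' => Or.inl hj')
    rcases List.mem_append.1 hw with hw | hw
    · exact Or.inl (loc_mem_cubes_of_pend loc obs (by rw [hp]; exact List.mem_cons_of_mem u hw))
    · exact Or.inr ⟨w, List.mem_of_mem_eraseIdx hw, rfl⟩
  have hy : loc ((legs m).getD j 0) ∈ loc '' {w | w ∈ legs m} :=
    ⟨_, by rw [List.getD_eq_getElem _ _ hj]; exact List.getElem_mem hj, rfl⟩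
  refine (diam_le_of_subset_union loc obs ((legs m).finite_toSet.image loc) hsub
    (loc_mem_cubes_of_pend loc obs (by rw [hp]; exact List.mem_cons_self)) hy).trans ?_
  exact add_le_add le_rfl (diam_image_le loc hr (hrv m))

end Cubes

end Literature.MathematicalPhysics.QuantumFieldTheory.BalabanImbrieJaffe1984to88.BIJ88ComponentCubes311

end
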